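import Literature.MathematicalPhysics.QuantumFieldTheory.Balaban1983to89.B9Thm37GlueTorusCovSup

/-!
# Literature: Bałaban's propagators for lattice gauge theories [B9] — G∇\*_U: the SUP-NORM, LOCALIZED-SOURCE
decay of (Δ_U + a·Q_UᵀQ_U)⁻¹∇\*_U, uniform in the transport and in the volume (pv21 node HOM-PU-COVDT; MODEL)

Sources (bib keys):
* [B9] = `Balaban1985BackgroundPropagators` — T. Bałaban, *Propagators for lattice gauge theories in a background
  field*, Commun. Math. Phys. 99 (1985) 389–434.
* The torus row sums `B4Sect5Torus.torusSum_le` with the constant `B4Sect5Proof.latticeConst`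
  K_d(κ) = (2(1 − e^{−κ/d})⁻¹)^d are KERNEL theorems of this directory's files on Sect. 5 of the series' paper B4
  (T. Bałaban, *Regularity and decay of lattice Green's functions*, Commun. Math. Phys. 89 (1983) 571–597, bib key
  `Balaban1983RegularityDecay`), reused BY NAME; nothing of that paper is quoted or asserted here.

THE PRINTED LOCI.  NO new «» span in this file.  Context, quoted or paraphrased in the headers of modules this file
imports: [B9] (3.18)–(3.19) p. 393 (the one-step covariant averaging; `B9Thm37GlueTorusCov`), (3.3) pp. 390–391 and
(3.8) p. 392 (∇_U and its adjoint ∇\*_U = D\*; `B9Thm37Glue.covD`, `B9Thm37Glue.covDT`, `B9Thm37Glue.isTransposePair_covD`),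
(3.23)–(3.24) p. 394 (Δ′_a = Δ_U + Q′\*aQ′; `B9Thm37Glue`), p. 395 (positivity of Δ′_a under a regularity
assumption on U; `B9Thm37Glue`, `B9Thm37GlueTorusInv`), and Theorem 3.1 with its display (3.42) p. 397
(`B9Thm37Glue`, `B9Thm37GlueTorusCovCT` v1.1, `B9Thm37GlueTorusCovSup` v1.1, `B9Thm37GlueTorusCovLap`; the
directory's rendering `B9.KernelFamily` / `B9.pref4`).  Paraphrase of that display (page read as an image; no
quotation): Theorem 3.1 provides constants M₁, δ₀, a₀, B₀ depending on d and L only such that for M ≥ M₁ and every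
configuration U satisfying the regularity condition (3.35) with Mα₀ ≤ a₀, the operator G′(U) (with a = 1) obeys,
for y ∈ Λ_j, x ∈ Δ(y) and λ supported in Δ(y′), bounds on the four quantities |(G′(U)λ)(x)|, |(∇_U G′(U)λ)(x)|,
|(G′(U)∇\*_U λ)(x)|, |(Δ_U G′(U)λ)(x)| by B₀ times the scale prefactor (L^jη)², L^jη, L^jη, 1 respectively, times
e^{−δ₀d(y,y′)}·|λ| (|λ| the supremum norm (3.39), d(y, y′) the weighted distance of [B9]'s reference [4]).  This file
concerns the SHAPE of the THIRD entry — G′∇\*_U applied to a BOND field λ localized near a site set, prefactor L^jη —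
for the lineage's one-step model; entries one, two and four are `B9Thm37GlueTorusCovSup.sup_decay_torus`,
`B9Thm37GlueTorusCovSup.covD_sup_decay_torus` and `B9Thm37GlueTorusCovLap.lap_sup_decay_torus`.

THE POINT.  G = (Δ_U + a·Q_UᵀQ_U)⁻¹ is a genuine two-sided inverse of a SYMMETRIC operator
(`B9Thm37GlueTorusCov.isTransposePair_covLapCov`, `B9Thm37GlueTorusCov.mul_inverse_covLapCov`), hence symmetric
itself (`isTransposePair_inverse_covLapCov`, via `B9Thm37GlueSz.isTransposePair_inv`), and ∇\*_U = `covDT` is the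
transpose of ∇_U = `covD` (`B9Thm37Glue.isTransposePair_covD`).  Consequently the kernel of G∇\*_U is the TRANSPOSE
of the kernel of ∇_U G:  (G∇\*_U λ)(p) = Σ_q λ(q)·(∇_U Gδ_p)(q)  (`apply_transpose_eq_sum`, `inverse_covDT_apply`,
`inverse_covDT_single`), and the third entry of the (3.42) shape is read off the second one with source and
evaluation exchanged:

* §1 (generic, any finite index types) `apply_single_eq_of_isTransposePair` ((Gδ_{x′})(x) = (Gᵀδ_x)(x′)),
  `apply_transpose_eq_sum` ((G Dᵀλ)(x) = Σ_q λ(q)(D Gᵀδ_x)(q) for transpose pairs (G, Gᵀ), (D, Dᵀ)); for every comb: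
  `isTransposePair_inverse_covLapCov`, `inverse_single_symm`, `inverse_covDT_apply`, `inverse_covDT_single`;
* §2 (any finite pseudometric site space) `sum_bond_localized_le`: the localized row sum of
  `B9Thm37GlueTorusCovSup.sum_localized_le` RE-INDEXED OVER BONDS b = (y, μ) through their starting points y = b₋
  (a bond field on (St × Dir) × Cp is a site field on St × (Dir × Cp));
* §3 THE TORUS (`UT N`, 1 ≤ M₀ ∣ N_i, nearest-neighbour bonds (y, μ): y → y + e_μ of `B9Thm37GluePU`):
  **`covD_entry_decay_torus`**: |(∇_U Gδ_{p₀})(b, k)| ≤ c_max·(|Cp| + 1)·e^{θ_T}·(2/σ_T)·e^{−θ_T·dist(p₀,₁, b₋)} at the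
  FULL rate θ_T of `B9Thm37GlueTorusCovCT.entry_decay_torus_explicit` (the far endpoint b₊ costs e^{θ_T}, the
  isometry R(b) the factor |Cp|); by transposition **`covDT_entry_decay_torus`**: the same bound for
  |(G∇\*_U δ_{q₀})(p)| with q₀ = (b, k); and the (3.42)₃-SHAPED statement **`covDT_sup_decay_torus`**: for every
  isometric transport, all weights in the ranges of `entry_decay_torus_explicit`, every site set Y, every bond field
  λ vanishing on the bonds that do not START in Y, |λ| ≤ m, every point p and every R with R ≤ dist(y, p₁) for all
  y ∈ Y:  |(G∇\*_U λ)(p)| ≤ c_max·(|Cp| + 1)·e^{θ_T}·d·B_T·e^{−(θ_T/2)·R}·m  with B_T = `B9Thm37GlueTorusCovSup.supConst`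
  (= (2/σ_T)·|Cp|·K_d(θ_T/2)) and θ_T = `B9Thm37GlueTorusCovCT.thetaTorus` > 0 — the SAME rate θ_T/2 as entries one,
  two and four; **`covDT_sup_bound_torus`** (Y = everything, R = 0): ‖G∇\*_U‖_{ℓ^∞ → ℓ^∞} ≤ c_max·(|Cp| + 1)·e^{θ_T}·d·B_T.
  All constants depend on (d, M₀, a, c_min, c_max, w_min, w_max, |Cp|) only — UNIFORM in the torus and in U.

HONEST SCOPE / NOT ASSERTED.  This is the lineage's ONE-STEP MODEL (one covariant averaging Q_U over cubic blocks of
side M₀ with a comb transport, unit lattice), not print's multiscale G′(U) of Theorem 3.1 (a sequence of averagings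
Q′_j(U) with the weights of (3.16)/(3.24), the weighted distance d(y, y′), Hölder norms, the regularity condition
(3.35) on U, the side conditions M ≥ M₁, Mα₀ ≤ a₀, a = 1, constants depending on d and L only); print's Theorem 3.1,
its constants δ₀, B₀ (and B₀(β) of the Hölder entries) and its random-walk proof are not asserted, approximated or
used — only the shape of its third pointwise entry is modelled, with λ's support cube Δ(y′) read as the set of bonds
starting in the site set Y (the author's reading for the model, not print's), the sup torus distance of
`B5TorusCover.UT`, and the crude constants of `B9Thm37GlueTorusCovCT`/`…CovSup` (print's prefactor L^jη
has no counterpart on the one-scale unit lattice; it is absorbed in the constant).  In the model NO regularity of U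
is needed (the transport enters only through isometries).  Here ∇\*_U denotes the model's `covDT` (bond weights c(b),
transport R(b); for orthogonal R(b) and U(x, x′) = U(x′, x)⁻¹ it is the displayed D\* of (3.8) read in components, as
recorded in `B9Thm37Glue`).  The Hölder entries (3.43)–(3.45) and (3.46)–(3.47) are not modelled.  (v1.1 = DOCFIX,
docstring-only: the gloss on λ's support no longer stands in quotation marks — no text of this file is quoted from
print — per the cross-read of v1, cell journal l.56897, GAPS C-adv9-110; all twelve theorems, statements and proofs
unchanged.)  value = kernel certificate (MODEL), NOT summit progress; NOT continuum, NOT Clay.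
-/

namespace Literature.MathematicalPhysics.QuantumFieldTheory.Balaban1983to89.B9Thm37GlueTorusCovDT

noncomputable section

open Finset B9Thm37Glue B9Thm37GluePU B9Thm37GlueTorusCov B9Thm37GlueTorusCovPoinc B9Thm37GlueTorusCovCT
  B9Thm37GlueTorusCovSup
open B5TorusCover (UT Ctr)
open B5Leibniz121 (up dist_up_le)

/-! ## §1  Transposition: symmetric inverse, and the kernel of G∇\*_U as the transpose of the kernel of ∇_U G -/

section Transpose

variable {X Y : Type} [Fintype X] [DecidableEq X] [Fintype Y]

/-- Σ_y u(y)·δ_x(y) = u(x). [folklore] -/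
theorem sum_mul_single (u : X → ℝ) (x : X) : ∑ y, u y * Pi.single (M := fun _ : X => ℝ) x (1 : ℝ) y = u x := by
  rw [Fintype.sum_eq_single x (fun y hy => by rw [Pi.single_eq_of_ne hy, mul_zero]), Pi.single_eq_same, mul_one]

/-- **Entries of a transpose pair are exchanged**: (Gδ_{x′})(x) = (Gᵀδ_x)(x′). [folklore] -/
theorem apply_single_eq_of_isTransposePair {G G' : Module.End ℝ (X → ℝ)} (hG : IsTransposePair G G') (x x' : X) :
    G (Pi.single x' 1) x = G' (Pi.single x 1) x' := by
  have h := hG (Pi.single x' 1) (Pi.single x 1)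
  rw [sum_mul_single] at h
  rw [h, Fintype.sum_eq_single x' (fun y hy => by rw [Pi.single_eq_of_ne hy, zero_mul]), Pi.single_eq_same,
    one_mul]

/-- **The kernel of G∘Dᵀ is the transpose of the kernel of D∘Gᵀ**: for transpose pairs (G, Gᵀ) on X and (D, Dᵀ)
between X and Y, (G(Dᵀλ))(x) = Σ_q λ(q)·(D(Gᵀδ_x))(q). [folklore] -/
theorem apply_transpose_eq_sum {G G' : Module.End ℝ (X → ℝ)} (hG : IsTransposePair G G')
    {D : (X → ℝ) →ₗ[ℝ] (Y → ℝ)} {Dt : (Y → ℝ) →ₗ[ℝ] (X → ℝ)} (hD : IsTransposePair D Dt) (lam : Y → ℝ) (x : X) :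
    G (Dt lam) x = ∑ q, lam q * D (G' (Pi.single x 1)) q := by
  have h1 : G (Dt lam) x = ∑ x', Dt lam x' * G' (Pi.single x 1) x' := by
    rw [← hG (Dt lam) (Pi.single x 1), sum_mul_single]
  have h2 : ∑ q, D (G' (Pi.single x 1)) q * lam q = ∑ x', G' (Pi.single x 1) x' * Dt lam x' :=
    hD (G' (Pi.single x 1)) lam
  rw [h1]
  calc ∑ x', Dt lam x' * G' (Pi.single x 1) x' = ∑ x', G' (Pi.single x 1) x' * Dt lam x' :=
        Finset.sum_congr rfl fun x' _ => mul_comm _ _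
    _ = ∑ q, D (G' (Pi.single x 1)) q * lam q := h2.symm
    _ = ∑ q, lam q * D (G' (Pi.single x 1)) q := Finset.sum_congr rfl fun q _ => mul_comm _ _

end Transpose

section Generic

variable {St Bd B Cp : Type} [Fintype St] [DecidableEq St] [Fintype Bd] [Fintype B] [DecidableEq B]
  [Fintype Cp] [DecidableEq Cp] {src tgt : Bd → St} (K : Comb src tgt B) (c : Bd → ℝ) (w : B → ℝ)
  (Rm : Bd → Cp → Cp → ℝ)

/-- **G = (Δ_U + a·Q_UᵀQ_U)⁻¹ is SYMMETRIC** for the component pairing (a > 0, non-zero weights, isometric bond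
matrices): the two-sided inverse of a symmetric unit. [cite: Balaban1985BackgroundPropagators, (3.23)–(3.24) p.394 + p.391] -/
theorem isTransposePair_inverse_covLapCov
    (hRm : ∀ b i j, ∑ k, Rm b k i * Rm b k j = if i = j then (1 : ℝ) else 0) (hc : ∀ b, c b ≠ 0)
    (hw : ∀ β, w β ≠ 0) {a : ℝ} (ha : 0 < a) :
    IsTransposePair (Ring.inverse (covLapCov K c w Rm a)) (Ring.inverse (covLapCov K c w Rm a)) :=
  B9Thm37GlueSz.isTransposePair_inv (isTransposePair_covLapCov K c w Rm a)
    (mul_inverse_covLapCov K c w Rm hRm hc hw ha) (mul_inverse_covLapCov K c w Rm hRm hc hw ha)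

/-- Symmetric entries of G: (Gδ_{p′})(p) = (Gδ_p)(p′). [folklore] -/
theorem inverse_single_symm
    (hRm : ∀ b i j, ∑ k, Rm b k i * Rm b k j = if i = j then (1 : ℝ) else 0) (hc : ∀ b, c b ≠ 0)
    (hw : ∀ β, w β ≠ 0) {a : ℝ} (ha : 0 < a) (p p' : St × Cp) :
    Ring.inverse (covLapCov K c w Rm a) (Pi.single p' 1) p =
      Ring.inverse (covLapCov K c w Rm a) (Pi.single p 1) p' :=
  apply_single_eq_of_isTransposePair (isTransposePair_inverse_covLapCov K c w Rm hRm hc hw ha) p p'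

/-- **THE ADJOINT REPRESENTATION OF G∇\*_U (MODEL)**: (G∇\*_U λ)(p) = Σ_q λ(q)·(∇_U Gδ_p)(q) for every bond field λ —
the kernel of G∇\*_U is the transpose of the kernel of ∇_U G (G symmetric, ∇\*_U = (∇_U)ᵀ).
[cite: Balaban1985BackgroundPropagators, (3.8) p.392 + (3.23)–(3.24) p.394] -/
theorem inverse_covDT_apply
    (hRm : ∀ b i j, ∑ k, Rm b k i * Rm b k j = if i = j then (1 : ℝ) else 0) (hc : ∀ b, c b ≠ 0)
    (hw : ∀ β, w β ≠ 0) {a : ℝ} (ha : 0 < a) (lam : Bd × Cp → ℝ) (p : St × Cp) :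
    Ring.inverse (covLapCov K c w Rm a) (covDT src tgt c Rm lam) p =
      ∑ q, lam q * covD src tgt c Rm (Ring.inverse (covLapCov K c w Rm a) (Pi.single p 1)) q :=
  apply_transpose_eq_sum (isTransposePair_inverse_covLapCov K c w Rm hRm hc hw ha)
    (isTransposePair_covD src tgt c Rm) lam p

/-- **The kernel of G∇\*_U is the transpose of the kernel of ∇_U G**: (G∇\*_U δ_{q₀})(p) = (∇_U Gδ_p)(q₀). [folklore] -/
theorem inverse_covDT_single
    (hRm : ∀ b i j, ∑ k, Rm b k i * Rm b k j = if i = j then (1 : ℝ) else 0) (hc : ∀ b, c b ≠ 0)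
    (hw : ∀ β, w β ≠ 0) {a : ℝ} (ha : 0 < a) [DecidableEq Bd] (q₀ : Bd × Cp) (p : St × Cp) :
    Ring.inverse (covLapCov K c w Rm a) (covDT src tgt c Rm (Pi.single q₀ 1)) p =
      covD src tgt c Rm (Ring.inverse (covLapCov K c w Rm a) (Pi.single p 1)) q₀ := by
  rw [inverse_covDT_apply K c w Rm hRm hc hw ha, Fintype.sum_eq_single q₀
    (fun q hq => by rw [Pi.single_eq_of_ne hq, zero_mul]), Pi.single_eq_same, one_mul]

end Generic

/-! ## §2  Localized row sums over BONDS through their starting points -/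

section BondSum

variable {St Dir Cp : Type} [PseudoMetricSpace St] [Fintype St] [Fintype Dir] [Fintype Cp]

/-- **Localized bond sums with decay**: if a bond field λ on (St × Dir) × Cp satisfies |λ| ≤ m (m ≥ 0), vanishes on
the bonds (y, μ) with y ∉ Y, and R ≤ dist(y, x) for all y ∈ Y, then for A, θ ≥ 0
Σ_{((y,μ),k)} |λ((y,μ),k)|·(A·e^{−θ·dist(x, y)}) ≤ A·m·e^{−(θ/2)R}·(|Dir|·|Cp|·Σ_{x′} e^{−(θ/2)·dist(x, x′)})
(`B9Thm37GlueTorusCovSup.sum_localized_le` re-indexed: a bond field is a site field with components Dir × Cp). [folklore] -/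
theorem sum_bond_localized_le {A θ m R : ℝ} (hA : 0 ≤ A) (hθ : 0 ≤ θ) (Y : Finset St) (x : St)
    (hR : ∀ y ∈ Y, R ≤ dist y x) (lam : (St × Dir) × Cp → ℝ) (hlamY : ∀ q, q.1.1 ∉ Y → lam q = 0)
    (hlamm : ∀ q, |lam q| ≤ m) (hm : 0 ≤ m) :
    ∑ q, |lam q| * (A * Real.exp (-(θ * dist x q.1.1))) ≤
      A * m * Real.exp (-(θ / 2 * R)) *
        ((Fintype.card Dir * Fintype.card Cp) * ∑ x', Real.exp (-(θ / 2 * dist x x'))) := by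
  classical
  -- re-index the bond field as a site field with components Dir × Cp
  set g : St × (Dir × Cp) → ℝ := fun p' => lam ((p'.1, p'.2.1), p'.2.2) with hg
  have hre : ∑ q, |lam q| * (A * Real.exp (-(θ * dist x q.1.1))) =
      ∑ p' : St × (Dir × Cp), |g p'| * (A * Real.exp (-(θ * dist p'.1 x))) := by
    refine Fintype.sum_equiv (Equiv.prodAssoc St Dir Cp) _ _ fun q => ?_
    obtain ⟨⟨y, μ⟩, k⟩ := q
    simp only [Equiv.prodAssoc_apply, hg, dist_comm x y]
  have hgY : ∀ p' : St × (Dir × Cp), p'.1 ∉ Y → g p' = 0 := fun p' hp' => hlamY ((p'.1, p'.2.1), p'.2.2) hp'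
  have hgm : ∀ p' : St × (Dir × Cp), |g p'| ≤ m := fun p' => hlamm _
  rw [hre]
  refine (sum_localized_le (Cp := Dir × Cp) hA hθ Y x hR g hgY hgm hm).trans (le_of_eq ?_)
  rw [Fintype.card_prod, Nat.cast_mul]

end BondSum

/-! ## §3  The torus: entrywise and sup-norm localized decay of (Δ_U + a·Q_UᵀQ_U)⁻¹∇\*_U, uniform in N and U -/

section Torus

variable {d : ℕ} {N : Fin d → ℕ} [∀ i, NeZero (N i)] [NeZero d]

/-- **ENTRYWISE DECAY OF ∇_U Gδ_{p₀} AT THE FULL RATE θ_T (MODEL).**  With G = (Δ_U + a·Q_UᵀQ_U)⁻¹ on the torus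
`UT N` (1 ≤ M₀, M₀ ∣ N_i), every isometric transport, c_min ≤ |c(b)| ≤ c_max (c_min > 0), w_min ≤ |w(z)| ≤ w_max
(w_min > 0), a > 0: for every point p₀, bond b and colour k,
|(∇_U Gδ_{p₀})(b, k)| ≤ c_max·(|Cp| + 1)·e^{θ_T}·(2/σ_T)·e^{−θ_T·dist(p₀,₁, b₋)}  (σ_T = `sigmaTorus`, θ_T =
`thetaTorus`; the far endpoint b₊ is at distance ≤ 1 from b₋ and costs e^{θ_T}, |R(b)_{kj}| ≤ 1 costs |Cp|).
[cite: Balaban1985BackgroundPropagators, (3.42) p.397; (3.3) pp.390–391; (3.23)–(3.24) p.394] -/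
theorem covD_entry_decay_torus {Cp : Type} [Fintype Cp] [DecidableEq Cp] {M₀ : ℕ} (hM : 1 ≤ M₀)
    (hdiv : ∀ i, M₀ ∣ N i) (c : UT N × Fin d → ℝ) {cmin cmax : ℝ} (hcmin : 0 < cmin) (hc : ∀ b, cmin ≤ |c b|)
    (hc' : ∀ b, |c b| ≤ cmax) (w : Ctr N M₀ → ℝ) {wmin wmax : ℝ} (hwmin : 0 < wmin) (hw : ∀ β, wmin ≤ |w β|)
    (hw' : ∀ β, |w β| ≤ wmax) (Rm : UT N × Fin d → Cp → Cp → ℝ)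
    (hRm : ∀ b i j, ∑ k, Rm b k i * Rm b k j = if i = j then (1 : ℝ) else 0) {a : ℝ} (ha : 0 < a)
    (p₀ : UT N × Cp) (b : UT N × Fin d) (k : Cp) :
    |covD bsrc btgt c Rm (Ring.inverse (covLapCov (torusComb hM hdiv) c w Rm a) (Pi.single p₀ 1)) (b, k)| ≤
      cmax * (Fintype.card Cp + 1) * Real.exp (thetaTorus d M₀ a wmin cmin cmax wmax) *
        (2 / sigmaTorus d M₀ a wmin cmin *
          Real.exp (-(thetaTorus d M₀ a wmin cmin cmax wmax * dist p₀.1 (bsrc b)))) := by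
  set θ := thetaTorus d M₀ a wmin cmin cmax wmax
  set A := 2 / sigmaTorus d M₀ a wmin cmin
  set G := Ring.inverse (covLapCov (torusComb hM hdiv) c w Rm a)
  have hθ0 : 0 < θ := thetaTorus_pos d M₀ ha hwmin cmin cmax wmax
  have hA0 : 0 ≤ A := div_nonneg (by norm_num) (sigmaTorus_pos d M₀ ha hwmin cmin).le
  -- the entrywise bound at any evaluation point
  have hent : ∀ q : UT N × Cp, |G (Pi.single p₀ 1) q| ≤ A * Real.exp (-(θ * dist p₀.1 q.1)) := fun q =>
    entry_decay_torus_explicit hM hdiv c hcmin hc hc' w hwmin hw hw' Rm hRm ha p₀ q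
  -- the far endpoint is at distance ≤ 1 from the near one
  have hfar : dist p₀.1 (bsrc b) ≤ dist p₀.1 (btgt b) + 1 := by
    have h1 : dist p₀.1 (bsrc b) ≤ dist p₀.1 (btgt b) + dist (btgt b) (bsrc b) := dist_triangle _ _ _
    have h2 : dist (btgt b) (bsrc b) ≤ 1 := by
      obtain ⟨y, μ⟩ := b
      rw [btgt_apply, bsrc_apply, dist_comm]
      exact dist_up_le y μ
    linarith
  -- the common majorant W = e^{θ}·A·e^{−θ·dist(p₀,₁, b₋)}
  set W := Real.exp θ * (A * Real.exp (-(θ * dist p₀.1 (bsrc b)))) with hWdef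
  have htgt : ∀ j, |G (Pi.single p₀ 1) (btgt b, j)| ≤ W := by
    intro j
    refine (hent (btgt b, j)).trans ?_
    rw [hWdef, ← mul_assoc, mul_comm (Real.exp θ) A, mul_assoc, ← Real.exp_add]
    refine mul_le_mul_of_nonneg_left (Real.exp_le_exp.mpr ?_) hA0
    have := mul_le_mul_of_nonneg_left hfar hθ0.le
    simp only at this ⊢
    linarith
  have hsrc : |G (Pi.single p₀ 1) (bsrc b, k)| ≤ W := by
    refine (hent (bsrc b, k)).trans ?_
    rw [hWdef]
    exact le_mul_of_one_le_left (mul_nonneg hA0 (Real.exp_pos _).le) (Real.one_le_exp hθ0.le)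
  have hcmax : 0 ≤ cmax := (abs_nonneg _).trans (hc' b)
  rw [covD_apply]
  calc |c (b, k).1 * (∑ j, Rm (b, k).1 (b, k).2 j * G (Pi.single p₀ 1) (btgt (b, k).1, j) -
          G (Pi.single p₀ 1) (bsrc (b, k).1, (b, k).2))|
      ≤ cmax * (Fintype.card Cp * W + W) := by
        rw [abs_mul]
        refine mul_le_mul (hc' b) ?_ (abs_nonneg _) hcmax
        refine (abs_sub _ _).trans (add_le_add ?_ hsrc)
        refine (abs_sum_Rm_mul_le Rm hRm b k _).trans ?_
        calc ∑ j, |G (Pi.single p₀ 1) (btgt b, j)| ≤ ∑ _j : Cp, W := Finset.sum_le_sum fun j _ => htgt j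
          _ = Fintype.card Cp * W := by simp [Finset.sum_const, Finset.card_univ, nsmul_eq_mul]
    _ = cmax * (Fintype.card Cp + 1) * Real.exp θ * (A * Real.exp (-(θ * dist p₀.1 (bsrc b)))) := by
        rw [hWdef]; ring

/-- **ENTRYWISE DECAY OF G∇\*_U δ_{q₀} AT THE FULL RATE θ_T (MODEL of the third entry of (3.42), point source)** —
by transposition (`inverse_covDT_single`) the bound of `covD_entry_decay_torus` with source and evaluation exchanged:
|(G∇\*_U δ_{(b,k)})(p)| ≤ c_max·(|Cp| + 1)·e^{θ_T}·(2/σ_T)·e^{−θ_T·dist(p₁, b₋)}.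
[cite: Balaban1985BackgroundPropagators, (3.42) p.397; (3.8) p.392; (3.23)–(3.24) p.394] -/
theorem covDT_entry_decay_torus {Cp : Type} [Fintype Cp] [DecidableEq Cp] {M₀ : ℕ} (hM : 1 ≤ M₀)
    (hdiv : ∀ i, M₀ ∣ N i) (c : UT N × Fin d → ℝ) {cmin cmax : ℝ} (hcmin : 0 < cmin) (hc : ∀ b, cmin ≤ |c b|)
    (hc' : ∀ b, |c b| ≤ cmax) (w : Ctr N M₀ → ℝ) {wmin wmax : ℝ} (hwmin : 0 < wmin) (hw : ∀ β, wmin ≤ |w β|)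
    (hw' : ∀ β, |w β| ≤ wmax) (Rm : UT N × Fin d → Cp → Cp → ℝ)
    (hRm : ∀ b i j, ∑ k, Rm b k i * Rm b k j = if i = j then (1 : ℝ) else 0) {a : ℝ} (ha : 0 < a)
    (b : UT N × Fin d) (k : Cp) (p : UT N × Cp) :
    |Ring.inverse (covLapCov (torusComb hM hdiv) c w Rm a) (covDT bsrc btgt c Rm (Pi.single (b, k) 1)) p| ≤
      cmax * (Fintype.card Cp + 1) * Real.exp (thetaTorus d M₀ a wmin cmin cmax wmax) *
        (2 / sigmaTorus d M₀ a wmin cmin *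
          Real.exp (-(thetaTorus d M₀ a wmin cmin cmax wmax * dist p.1 (bsrc b)))) := by
  have hc0 : ∀ b', c b' ≠ 0 := fun b' h0 => by
    have := hc b'; rw [h0, abs_zero] at this; exact absurd this (not_le.mpr hcmin)
  have hw0 : ∀ β, w β ≠ 0 := fun β h0 => by
    have := hw β; rw [h0, abs_zero] at this; exact absurd this (not_le.mpr hwmin)
  rw [inverse_covDT_single (torusComb hM hdiv) c w Rm hRm hc0 hw0 ha (b, k) p]
  exact covD_entry_decay_torus hM hdiv c hcmin hc hc' w hwmin hw hw' Rm hRm ha p b k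

/-- **SUP-NORM, LOCALIZED-SOURCE DECAY OF (Δ_U + a·Q_UᵀQ_U)⁻¹∇\*_U ON EVERY TORUS, UNIFORM IN THE VOLUME AND IN THE
TRANSPORT (MODEL of the third inequality of (3.42)).**  For every torus `UT N` with 1 ≤ M₀, M₀ ∣ N_i, every
isometric transport (hRm), bond weights c_min ≤ |c(b)| ≤ c_max (c_min > 0), block weights w_min ≤ |w(z)| ≤ w_max
(w_min > 0), a > 0, every site set Y, every BOND field λ vanishing on the bonds (y, μ) with y ∉ Y and with |λ| ≤ m,
every point p and every R with R ≤ dist(y, p₁) for all y ∈ Y: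
|((Δ_U + a·Q_UᵀQ_U)⁻¹∇\*_U λ)(p)| ≤ c_max·(|Cp| + 1)·e^{θ_T}·d·B_T·e^{−(θ_T/2)·R}·m, with
B_T = `supConst d M₀ a wmin cmin cmax wmax |Cp|` and θ_T = `thetaTorus d M₀ a wmin cmin cmax wmax` > 0 (at most d
bonds start at a site).
[cite: Balaban1985BackgroundPropagators, (3.42) p.397; (3.8) p.392; (3.23)–(3.24) p.394; p.395] -/
theorem covDT_sup_decay_torus {Cp : Type} [Fintype Cp] [DecidableEq Cp] {M₀ : ℕ} (hM : 1 ≤ M₀)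
    (hdiv : ∀ i, M₀ ∣ N i) (c : UT N × Fin d → ℝ) {cmin cmax : ℝ} (hcmin : 0 < cmin) (hc : ∀ b, cmin ≤ |c b|)
    (hc' : ∀ b, |c b| ≤ cmax) (w : Ctr N M₀ → ℝ) {wmin wmax : ℝ} (hwmin : 0 < wmin) (hw : ∀ β, wmin ≤ |w β|)
    (hw' : ∀ β, |w β| ≤ wmax) (Rm : UT N × Fin d → Cp → Cp → ℝ)
    (hRm : ∀ b i j, ∑ k, Rm b k i * Rm b k j = if i = j then (1 : ℝ) else 0) {a : ℝ} (ha : 0 < a)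
    (Y : Finset (UT N)) (lam : (UT N × Fin d) × Cp → ℝ) (hlamY : ∀ q, bsrc q.1 ∉ Y → lam q = 0) {m : ℝ}
    (hlamm : ∀ q, |lam q| ≤ m) (p : UT N × Cp) {R : ℝ} (hR : ∀ y ∈ Y, R ≤ dist y p.1) :
    |Ring.inverse (covLapCov (torusComb hM hdiv) c w Rm a) (covDT bsrc btgt c Rm lam) p| ≤
      cmax * (Fintype.card Cp + 1) * Real.exp (thetaTorus d M₀ a wmin cmin cmax wmax) * d *
        (supConst d M₀ a wmin cmin cmax wmax (Fintype.card Cp) *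
          Real.exp (-(thetaTorus d M₀ a wmin cmin cmax wmax / 2 * R)) * m) := by
  classical
  set θ := thetaTorus d M₀ a wmin cmin cmax wmax
  set A := 2 / sigmaTorus d M₀ a wmin cmin with hAdef
  set G := Ring.inverse (covLapCov (torusComb hM hdiv) c w Rm a)
  set C := cmax * (Fintype.card Cp + 1) * Real.exp θ with hCdef
  have hθ0 : 0 < θ := thetaTorus_pos d M₀ ha hwmin cmin cmax wmax
  have hA0 : 0 ≤ A := div_nonneg (by norm_num) (sigmaTorus_pos d M₀ ha hwmin cmin).le
  have hc0 : ∀ b', c b' ≠ 0 := fun b' h0 => by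
    have := hc b'; rw [h0, abs_zero] at this; exact absurd this (not_le.mpr hcmin)
  have hw0 : ∀ β, w β ≠ 0 := fun β h0 => by
    have := hw β; rw [h0, abs_zero] at this; exact absurd this (not_le.mpr hwmin)
  have hm : 0 ≤ m := (abs_nonneg _).trans (hlamm ((p.1, (0 : Fin d)), p.2))
  have hcmax : 0 ≤ cmax := (abs_nonneg _).trans (hc' (p.1, (0 : Fin d)))
  have hC0 : 0 ≤ C := by rw [hCdef]; positivity
  -- the adjoint representation and the entrywise bound of ∇_U Gδ_p, bond by bond
  have hq : ∀ q : (UT N × Fin d) × Cp, |lam q * covD bsrc btgt c Rm (G (Pi.single p 1)) q| ≤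
      C * (|lam q| * (A * Real.exp (-(θ * dist p.1 (bsrc q.1))))) := by
    intro q
    obtain ⟨b, k⟩ := q
    rw [abs_mul]
    have h := covD_entry_decay_torus hM hdiv c hcmin hc hc' w hwmin hw hw' Rm hRm ha p b k
    calc |lam (b, k)| * |covD bsrc btgt c Rm (G (Pi.single p 1)) (b, k)|
        ≤ |lam (b, k)| * (C * (A * Real.exp (-(θ * dist p.1 (bsrc b))))) :=
          mul_le_mul_of_nonneg_left h (abs_nonneg _)
      _ = _ := by ring
  -- the localized bond sum (at most d bonds start at a site; half of the rate pays for the distance)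
  have hsum := sum_bond_localized_le (Dir := Fin d) (Cp := Cp) hA0 hθ0.le Y p.1 hR lam
    (fun q hq' => hlamY q hq') hlamm hm
  have h3 : ∑ x' : UT N, Real.exp (-(θ / 2 * dist p.1 x')) ≤ B4Sect5Proof.latticeConst d (θ / 2) :=
    B4Sect5Torus.torusSum_le d (UT.one_le N) (half_pos hθ0) (UT.toSite N p.1)
  have hpre : 0 ≤ A * m * Real.exp (-(θ / 2 * R)) := mul_nonneg (mul_nonneg hA0 hm) (Real.exp_pos _).le
  rw [inverse_covDT_apply (torusComb hM hdiv) c w Rm hRm hc0 hw0 ha lam p]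
  calc |∑ q, lam q * covD bsrc btgt c Rm (G (Pi.single p 1)) q|
      ≤ ∑ q, |lam q * covD bsrc btgt c Rm (G (Pi.single p 1)) q| := Finset.abs_sum_le_sum_abs _ _
    _ ≤ ∑ q, C * (|lam q| * (A * Real.exp (-(θ * dist p.1 (bsrc q.1))))) := Finset.sum_le_sum fun q _ => hq q
    _ = C * ∑ q : (UT N × Fin d) × Cp, |lam q| * (A * Real.exp (-(θ * dist p.1 q.1.1))) := by
        rw [Finset.mul_sum]; rfl
    _ ≤ C * (A * m * Real.exp (-(θ / 2 * R)) *
          ((Fintype.card (Fin d) * Fintype.card Cp) * ∑ x', Real.exp (-(θ / 2 * dist p.1 x')))) :=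
        mul_le_mul_of_nonneg_left hsum hC0
    _ ≤ C * (A * m * Real.exp (-(θ / 2 * R)) *
          ((Fintype.card (Fin d) * Fintype.card Cp) * B4Sect5Proof.latticeConst d (θ / 2))) :=
        mul_le_mul_of_nonneg_left (mul_le_mul_of_nonneg_left
          (mul_le_mul_of_nonneg_left h3 (by positivity)) hpre) hC0
    _ = _ := by rw [hCdef, hAdef, Fintype.card_fin]; unfold supConst; ring

/-- **THE ℓ^∞ → ℓ^∞ OPERATOR NORM OF (Δ_U + a·Q_UᵀQ_U)⁻¹∇\*_U IS BOUNDED UNIFORMLY IN THE VOLUME AND IN THE TRANSPORT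
(MODEL).**  |((Δ_U + a·Q_UᵀQ_U)⁻¹∇\*_U λ)(p)| ≤ c_max·(|Cp| + 1)·e^{θ_T}·d·B_T·m whenever |λ| ≤ m, for every torus,
every isometric transport and all weights in the stated ranges.
[cite: Balaban1985BackgroundPropagators, (3.42) p.397; (3.8) p.392; (3.23)–(3.24) p.394] -/
theorem covDT_sup_bound_torus {Cp : Type} [Fintype Cp] [DecidableEq Cp] {M₀ : ℕ} (hM : 1 ≤ M₀)
    (hdiv : ∀ i, M₀ ∣ N i) (c : UT N × Fin d → ℝ) {cmin cmax : ℝ} (hcmin : 0 < cmin) (hc : ∀ b, cmin ≤ |c b|)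
    (hc' : ∀ b, |c b| ≤ cmax) (w : Ctr N M₀ → ℝ) {wmin wmax : ℝ} (hwmin : 0 < wmin) (hw : ∀ β, wmin ≤ |w β|)
    (hw' : ∀ β, |w β| ≤ wmax) (Rm : UT N × Fin d → Cp → Cp → ℝ)
    (hRm : ∀ b i j, ∑ k, Rm b k i * Rm b k j = if i = j then (1 : ℝ) else 0) {a : ℝ} (ha : 0 < a)
    (lam : (UT N × Fin d) × Cp → ℝ) {m : ℝ} (hlamm : ∀ q, |lam q| ≤ m) (p : UT N × Cp) :
    |Ring.inverse (covLapCov (torusComb hM hdiv) c w Rm a) (covDT bsrc btgt c Rm lam) p| ≤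
      cmax * (Fintype.card Cp + 1) * Real.exp (thetaTorus d M₀ a wmin cmin cmax wmax) * d *
        (supConst d M₀ a wmin cmin cmax wmax (Fintype.card Cp) * m) := by
  have h := covDT_sup_decay_torus hM hdiv c hcmin hc hc' w hwmin hw hw' Rm hRm ha Finset.univ lam
    (fun q hq => absurd (mem_univ (bsrc q.1)) hq) hlamm p (R := 0) (fun y _ => dist_nonneg)
  simpa using h

end Torus

end

end Literature.MathematicalPhysics.QuantumFieldTheory.Balaban1983to89.B9Thm37GlueTorusCovDT
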